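import Summits.AtomisticToContinuum.Crystallization.Theorems.FrustratedLawDichotomyThickeningVacancyFloor
import Summits.AtomisticToContinuum.Crystallization.Theorems.FrustratedLawDichotomyVirial

/-!
# FrustratedLawDichotomy · crux `AperiodicFrustratedLawGap` (stmt-AtomisticToContinuum-27623) — COVARIANT THICKENING OF LAWS, part 5:
# the vacancy floor at EVERY hole (continuity upgrade from rational to all sites)
# (decomp-a2c, prover hand 2, structural share, generation 4)

`ae_forall_vacancyFloor_of_minimising` (part 4) gives the vacancy floor simultaneously at all RATIONAL sites and radii, seen from every atom.
Since the Lennard-Jones field `v ↦ Φ_μ(v) = ∫ V_LJ(‖q − v‖) dμ(q)` of a hard-core configuration is CONTINUOUS on the vacant region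
(`continuousAt_field`, dominated convergence with the bound `2¹²/12·‖q−z‖⁻¹² + 2⁶/6·‖q−z‖⁻⁶` on `B(z, s/2)`), the floor extends to EVERY site:

* `vacancyFloor_all_of_rat` — deterministic upgrade: a hard-core configuration satisfying the floor at all rational `(v, r)` satisfies it at all
  real `(z, s)`;
* `ae_forall_vacancyFloor_all_of_minimising` — **for a minimising point-stationary hard-core law, almost surely, for EVERY atom `y`, EVERY site `z`
  and EVERY radius `s > 0`: `(θ_y μ)(B(z,s)) = 0 → e⋆ ≤ Φ_{θ_y μ}(z) + ½ ∫ V_LJ⁺(‖q‖) d(θ_y μ)`** — no hole of the configuration is deeper than `e⋆`,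
  up to half the short-range repulsion of any anchoring atom.  All `[folklore]`.
-/

noncomputable section

namespace Summit.AtomisticToContinuum.Crystallization.Theorems.FrustratedLawDichotomyThickening

open MeasureTheory Metric Set Filter ProbabilityTheory Topology
open scoped ENNReal Topology BigOperators
open Literature.MathematicalPhysics.StatisticalMechanics Literature.Probability.Process
open Summit.AtomisticToContinuum.Crystallization.Theorems.ChargedEnergyGapNegative (E3 eStar)
open Summit.AtomisticToContinuum.Crystallization.Theorems.FrustratedLawDichotomyVirial (integrable_invPow)

variable {δ : ℝ} {P : Measure (Measure E3)}

/-- Inverse powers of the distance to a vacant site are summable over a hard-core configuration. [folklore] -/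
theorem integrable_invPow_sub (hδ : 0 < δ) {S : Set E3} (h0S : (0 : E3) ∈ S) (hsep : ∀ x ∈ S, ∀ y ∈ S, x ≠ y → δ ≤ dist x y)
    {z : E3} {s : ℝ} (hs : 0 < s) (hfar : ∀ q ∈ S, s ≤ dist q z) :
    Integrable (fun q : E3 => ‖q - z‖⁻¹ ^ 6) ((Measure.count : Measure E3).restrict S) ∧
    Integrable (fun q : E3 => ‖q - z‖⁻¹ ^ 12) ((Measure.count : Measure E3).restrict S) := by
  have hsep' : ∀ x ∈ insert z S, ∀ y ∈ insert z S, x ≠ y → min δ s ≤ dist x y := by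
    intro x hx y hy hxy
    rcases hx with rfl | hx <;> rcases hy with rfl | hy
    · exact absurd rfl hxy
    · rw [dist_comm]; exact (min_le_right _ _).trans (hfar y hy)
    · exact (min_le_right _ _).trans (hfar x hx)
    · exact (min_le_left _ _).trans (hsep x hx y hy hxy)
  have hins : IsRootedHardCore (min δ s) ((Measure.count : Measure E3).restrict (insert z S)) :=
    ⟨insert z S, Set.mem_insert_of_mem z h0S, hsep', rfl⟩
  have hθ := hins.map_sub ((count_restrict_singleton_ne_zero_iff _ z).2 (Set.mem_insert z S))
  obtain ⟨h6, h12⟩ := integrable_invPow (lt_min hδ hs) hθ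
  have hm6 : AEStronglyMeasurable (fun q : E3 => ‖q‖⁻¹ ^ 6) (((Measure.count : Measure E3).restrict (insert z S)).map fun x : E3 => x - z) :=
    (measurable_norm.inv.pow_const 6).aestronglyMeasurable
  have hm12 : AEStronglyMeasurable (fun q : E3 => ‖q‖⁻¹ ^ 12) (((Measure.count : Measure E3).restrict (insert z S)).map fun x : E3 => x - z) :=
    (measurable_norm.inv.pow_const 12).aestronglyMeasurable
  have hle : (Measure.count : Measure E3).restrict S ≤ (Measure.count : Measure E3).restrict (insert z S) :=
    Measure.restrict_mono (Set.subset_insert z S) le_rfl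
  exact ⟨((integrable_map_measure hm6 (measurable_sub_const z).aemeasurable).1 h6).mono_measure hle,
    ((integrable_map_measure hm12 (measurable_sub_const z).aemeasurable).1 h12).mono_measure hle⟩

/-- **The Lennard-Jones field of a hard-core configuration is continuous at every vacant site.** [folklore] -/
theorem continuousAt_field (hδ : 0 < δ) {μ : Measure E3} (hμ : IsRootedHardCore δ μ) {z : E3} {s : ℝ} (hs : 0 < s)
    (hvac : μ (ball z s) = 0) :
    ContinuousAt (fun v : E3 => ∫ q, lennardJones ‖q - v‖ ∂μ) z := by
  have hLJm : Measurable lennardJones := by unfold lennardJones; fun_prop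
  -- `|V_LJ(t)| ≤ t⁻¹²/12 + t⁻⁶/6` (in the tree as `FrustratedLawDichotomyVacancyField.abs_lennardJones_le`, whose module cannot be imported next to
  -- this cone — Literature `UniformlyDiscrete` double; inlined)
  have abs_lennardJones_le : ∀ t : ℝ, |lennardJones t| ≤ 1 / 12 * t⁻¹ ^ 12 + 1 / 6 * t⁻¹ ^ 6 := fun t => by
    unfold lennardJones
    have h12 : 0 ≤ t⁻¹ ^ 12 := by positivity
    have h6 : 0 ≤ t⁻¹ ^ 6 := by positivity
    rw [abs_le]
    constructor <;> nlinarith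
  have hμ' := hμ
  obtain ⟨S, h0S, hsep, rfl⟩ := hμ
  have hfar : ∀ q ∈ S, s ≤ dist q z := fun q hq => by
    have := le_dist_of_vacant (p := 0) hμ' ((count_restrict_singleton_ne_zero_iff S q).2 hq) (by simpa using hvac)
    simpa using this
  obtain ⟨h6, h12⟩ := integrable_invPow_sub hδ h0S hsep hs hfar
  have hae : ∀ᵐ q ∂((Measure.count : Measure E3).restrict S), q ∈ S :=
    Summit.AtomisticToContinuum.Crystallization.Theorems.FrustratedLawDichotomyFiniteClusterGap.ae_mem_of_sep hδ hsep
  refine continuousAt_of_dominated (bound := fun q => 1 / 12 * (2 ^ 12 * ‖q - z‖⁻¹ ^ 12) + 1 / 6 * (2 ^ 6 * ‖q - z‖⁻¹ ^ 6)) ?_ ?_ ?_ ?_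
  · exact Filter.Eventually.of_forall fun v => (hLJm.comp ((measurable_id.sub_const v).norm)).aestronglyMeasurable
  · have hnear : ∀ᶠ v in 𝓝 z, dist v z < s / 2 := Metric.ball_mem_nhds z (half_pos hs)
    filter_upwards [hnear] with v hv
    filter_upwards [hae] with q hq
    have hqz : s ≤ ‖q - z‖ := by rw [← dist_eq_norm]; exact hfar q hq
    have hqv : ‖q - z‖ / 2 ≤ ‖q - v‖ := by
      have h1 : ‖q - z‖ ≤ ‖q - v‖ + ‖v - z‖ := by
        have := norm_sub_le_norm_sub_add_norm_sub q v z
        exact this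
      rw [← dist_eq_norm v z] at h1
      linarith
    have hqz0 : 0 < ‖q - z‖ := lt_of_lt_of_le hs hqz
    have hqv0 : 0 < ‖q - v‖ := lt_of_lt_of_le (half_pos hqz0) hqv
    have hinv : ‖q - v‖⁻¹ ≤ 2 * ‖q - z‖⁻¹ := by
      rw [show 2 * ‖q - z‖⁻¹ = (‖q - z‖ / 2)⁻¹ by field_simp]
      exact inv_anti₀ (half_pos hqz0) hqv
    have hinv0 : 0 ≤ ‖q - v‖⁻¹ := inv_nonneg.2 (norm_nonneg _)
    have hp6 : ‖q - v‖⁻¹ ^ 6 ≤ 2 ^ 6 * ‖q - z‖⁻¹ ^ 6 := by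
      calc ‖q - v‖⁻¹ ^ 6 ≤ (2 * ‖q - z‖⁻¹) ^ 6 := pow_le_pow_left₀ hinv0 hinv 6
        _ = 2 ^ 6 * ‖q - z‖⁻¹ ^ 6 := by ring
    have hp12 : ‖q - v‖⁻¹ ^ 12 ≤ 2 ^ 12 * ‖q - z‖⁻¹ ^ 12 := by
      calc ‖q - v‖⁻¹ ^ 12 ≤ (2 * ‖q - z‖⁻¹) ^ 12 := pow_le_pow_left₀ hinv0 hinv 12
        _ = 2 ^ 12 * ‖q - z‖⁻¹ ^ 12 := by ring
    rw [Real.norm_eq_abs]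
    calc |lennardJones ‖q - v‖| ≤ 1 / 12 * ‖q - v‖⁻¹ ^ 12 + 1 / 6 * ‖q - v‖⁻¹ ^ 6 := abs_lennardJones_le _
      _ ≤ 1 / 12 * (2 ^ 12 * ‖q - z‖⁻¹ ^ 12) + 1 / 6 * (2 ^ 6 * ‖q - z‖⁻¹ ^ 6) := by gcongr
  · exact ((h12.const_mul (2 ^ 12)).const_mul (1 / 12)).add ((h6.const_mul (2 ^ 6)).const_mul (1 / 6))
  · filter_upwards [hae] with q hq
    have hqz0 : ‖q - z‖ ≠ 0 := by
      have hqz : s ≤ ‖q - z‖ := by rw [← dist_eq_norm]; exact hfar q hq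
      exact (lt_of_lt_of_le hs hqz).ne'
    have hc : ContinuousAt (fun v : E3 => ‖q - v‖) z := (continuous_const.sub continuous_id).norm.continuousAt
    have hg : ContinuousAt lennardJones ((fun v : E3 => ‖q - v‖) z) :=
      continuousOn_lennardJones.continuousAt (isOpen_compl_singleton.mem_nhds hqz0)
    show ContinuousAt (lennardJones ∘ fun v : E3 => ‖q - v‖) z
    exact ContinuousAt.comp hg hc

/-- **Deterministic upgrade: the floor at all rational sites and radii gives the floor at every site and radius.** [folklore] -/
theorem vacancyFloor_all_of_rat (hδ : 0 < δ) {μ : Measure E3} (hμ : IsRootedHardCore δ μ) {c : ℝ}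
    (h : ∀ v : Fin 3 → ℚ, ∀ r : ℚ, 0 < (r : ℝ) →
      μ (ball ((EuclideanSpace.equiv (Fin 3) ℝ).symm fun i => (v i : ℝ)) r) = 0 →
        eStar ≤ (∫ q, lennardJones ‖q - (EuclideanSpace.equiv (Fin 3) ℝ).symm (fun i => (v i : ℝ))‖ ∂μ) + c)
    (z : E3) {s : ℝ} (hs : 0 < s) (hvac : μ (ball z s) = 0) :
    eStar ≤ (∫ q, lennardJones ‖q - z‖ ∂μ) + c := by
  by_contra hlt
  rw [not_le] at hlt
  -- by continuity the strict inequality persists near `z`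
  have hcont := continuousAt_field hδ hμ hs hvac
  have hopen : ∀ᶠ v in 𝓝 z, (∫ q, lennardJones ‖q - v‖ ∂μ) + c < eStar :=
    (hcont.add continuousAt_const).eventually (gt_mem_nhds hlt)
  obtain ⟨ε, hε, hball⟩ := Metric.eventually_nhds_iff.1 hopen
  -- a rational point within `min ε (s/2)` of `z` and a rational radius below `s/2`
  obtain ⟨r, hr0, hrs⟩ := exists_rat_btwn (half_pos hs)
  -- rational points are dense in `ℝ³` (also `EquilibriumInLaw.denseRange_ratPt`, whose module is not importable here)
  have hdr : DenseRange fun v : Fin 3 → ℚ => (EuclideanSpace.equiv (Fin 3) ℝ).symm fun c => (v c : ℝ) := by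
    have h1 : DenseRange (Pi.map fun _ : Fin 3 => (Rat.cast : ℚ → ℝ)) := DenseRange.piMap fun _ => Rat.denseRange_cast
    have h2 : DenseRange ((EuclideanSpace.equiv (Fin 3) ℝ).symm : (Fin 3 → ℝ) → E3) :=
      (EuclideanSpace.equiv (Fin 3) ℝ).symm.surjective.denseRange
    exact h2.comp h1 (EuclideanSpace.equiv (Fin 3) ℝ).symm.continuous
  have hdense := hdr.exists_dist_lt z (lt_min hε (half_pos hs))
  obtain ⟨v, hv⟩ := hdense
  set w : E3 := (EuclideanSpace.equiv (Fin 3) ℝ).symm fun i => (v i : ℝ) with hw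
  have hvz : dist w z < min ε (s / 2) := by rw [dist_comm]; exact hv
  -- the rational ball is vacant
  have hsub : ball w (r : ℝ) ⊆ ball z s := by
    intro x hx
    rw [mem_ball] at hx ⊢
    calc dist x z ≤ dist x w + dist w z := dist_triangle _ _ _
      _ < r + s / 2 := add_lt_add hx (lt_of_lt_of_le hvz (min_le_right _ _))
      _ < s := by linarith
  have hvac' : μ (ball w (r : ℝ)) = 0 := measure_mono_null hsub hvac
  have h1 := h v r (by exact_mod_cast hr0) hvac'
  have h2 := hball (lt_of_lt_of_le hvz (min_le_left _ _))
  exact absurd h1 (not_le.2 h2)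

/-- **THE VACANCY FLOOR AT EVERY HOLE, SEEN FROM EVERY ATOM.**  Granted the floor of item 9229: for a minimising point-stationary `δ`-hard-core
probability law, almost surely, for EVERY atom `y`, EVERY site `z` and EVERY radius `s > 0`, if `z` is `s`-vacant in `θ_y μ` then
`e⋆ ≤ ∫ V_LJ(‖q − z‖) d(θ_y μ) + ½ ∫ V_LJ⁺(‖q‖) d(θ_y μ)`. [folklore] -/
theorem ae_forall_vacancyFloor_all_of_minimising
    (hU : ∀ δ' : ℝ, 0 < δ' → ∀ Q : Measure (Measure E3), IsProbabilityMeasure Q → (∀ᵐ μ ∂Q, IsRootedHardCore δ' μ) →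
      IsPointStationaryLaw Q → eStar ≤ ∫ μ, rootEnergy lennardJones μ ∂Q)
    (hδ : 0 < δ) [IsProbabilityMeasure P] (hcore : ∀ᵐ μ ∂P, IsRootedHardCore δ μ) (hstat : IsPointStationaryLaw P)
    (hE : ∫ μ, rootEnergy lennardJones μ ∂P ≤ eStar) :
    ∀ᵐ μ ∂P, ∀ y : E3, μ {y} ≠ 0 → ∀ z : E3, ∀ s : ℝ, 0 < s → (μ.map fun x : E3 => x - y) (ball z s) = 0 →
      eStar ≤ (∫ q, lennardJones ‖q - z‖ ∂(μ.map fun x : E3 => x - y)) + (∫ q, max (lennardJones ‖q‖) 0 ∂(μ.map fun x : E3 => x - y)) / 2 := by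
  filter_upwards [hcore, ae_forall_vacancyFloor_of_minimising hU hδ hcore hstat hE] with μ hμ hrat y hy z s hs hvac
  exact vacancyFloor_all_of_rat hδ (hμ.map_sub hy) (hrat y hy) z hs hvac

end Summit.AtomisticToContinuum.Crystallization.Theorems.FrustratedLawDichotomyThickening

end
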